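import Summits.ValiantsHypothesis.ValiantsHypothesis.Theorems.SymPencilSingSixClassificationCaseGraph

/-!
# Route `SymPencil` — SING-SIX CLASSIFICATION, Theorem A (T6′): every `6`-dimensional linear
# subspace of `Sing Z(per₄)` lies in a cross, has two zero rows / columns, or is an exotic
# one-zero-line family `V_λ`, `V^gr` (ᵀ) — VERBATIM port, part 5/10 (`--supports`
# stmt-ValiantsHypothesis-5674 `SdcSuperquadratic`; rung currency only, nothing here bears on `VP ≠ VNP`)

PORT NOTE (val-width-5674-w2 g0′, helper mode; director-valiant R223 (a)): part 5/10 of a VERBATIM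
port of val-idea-18 g3/g4's SORRY-FREE Theorem A of `Cruxes/SdcSuperquadratic/Lines/
sing_six_classification.lean` rev 2.6 (sha256 dfb5f805c61d14b7…; here: `productAbsorb_01` … `prodGen_apply`).
ALL mathematics and proofs are val-idea-18's (memo `SING-SIX-CLASSIFICATION.md`); the port changes
only the file split, the linear import chain, the namespace, and one-line docstrings on API lemmas.
NOT ported: the `sorry`-stubs of LIST leaves 3–5 and `sixDim_perDir_list` (leaves 3, 4 = landed
`SymPencilPerFourExoticNoSixSquares` / `SymPencilPerFourCrossFilter`; leaf 5 open).
  Cut table: see part 1 (`…Defs`).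
Honest label: Theorem A of a line, not the crux, not the LIST; `27 ≤ sdc(per₄) ≤ 29` unchanged; stmt-5674
open; `VP ≠ VNP` not moved; no summit statement is proved here. [folklore]
-/

noncomputable section
set_option linter.dupNamespace false
set_option linter.unusedVariables false
set_option linter.unusedSectionVars false

namespace Summit.ValiantsHypothesis.ValiantsHypothesis.Theorems.SymPencilSingSixClassification

open MvPolynomial Module Literature.Computability.AlgebraicComplexity
open Literature.Barriers.CriticalPhenomena.Haruspicy (fin4_cases)
variable {K : Type*} [Field K]

/-- `ProductAbsorb` in the coordinates `j = 0`, `c = 1` (a linear system in the `16` entries of `χ`,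
solved by evaluating the hypothesis at `e_n` and `e_n + e_{n'}`). -/
theorem productAbsorb_01 [CharZero K] (α β : K) (χ : (Fin 4 → K) →ₗ[K] (Fin 4 → K))
    (hαβ : α ≠ 0 ∨ β ≠ 0) (h : ∀ u l, T3 u (lvec 0 1 α β) (χ u) l = 0) (u : Fin 4 → K) :
    ∃ μ : K, χ u = μ • lvec 0 1 α (-β) := by
  have hm : ∀ u, u 2 * χ u 3 + u 3 * χ u 2 = 0 := by
    intro u
    rcases hαβ with hα | hβ
    · have := h u 1
      rw [(T3_lvec01 α β u (χ u)).2.1] at this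
      exact (mul_eq_zero.mp this).resolve_left hα
    · have := h u 0
      rw [(T3_lvec01 α β u (χ u)).1] at this
      exact (mul_eq_zero.mp this).resolve_left hβ
  have hE2 : ∀ u, (β * u 0 + α * u 1) * χ u 3 + u 3 * (β * χ u 0 + α * χ u 1) = 0 := fun u => by
    have := h u 2
    rwa [(T3_lvec01 α β u (χ u)).2.2.1] at this
  have hE3 : ∀ u, (β * u 0 + α * u 1) * χ u 2 + u 2 * (β * χ u 0 + α * χ u 1) = 0 := fun u => by
    have := h u 3
    rwa [(T3_lvec01 α β u (χ u)).2.2.2] at this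
  -- the linear system
  have a1 := hm (Pi.single 2 1)
  have a2 := hm (Pi.single 3 1)
  have a3 := hm (Pi.single 2 1 + Pi.single 3 1)
  have a4 := hm (Pi.single 2 1 + Pi.single 0 1)
  have a5 := hm (Pi.single 2 1 + Pi.single 1 1)
  have a6 := hm (Pi.single 3 1 + Pi.single 0 1)
  have a7 := hm (Pi.single 3 1 + Pi.single 1 1)
  have b1 := hE2 (Pi.single 3 1)
  have b2 := hE2 (Pi.single 3 1 + Pi.single 0 1)
  have b3 := hE2 (Pi.single 3 1 + Pi.single 1 1)
  have c1 := hE3 (Pi.single 2 1)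
  have c2 := hE3 (Pi.single 2 1 + Pi.single 0 1)
  have c3 := hE3 (Pi.single 2 1 + Pi.single 1 1)
  simp at a1 a2 a3 a4 a5 a6 a7 b1 b2 b3 c1 c2 c3
  have hX22 : χ (Pi.single 2 1) 2 = 0 := by
    rcases hαβ with hα | hβ
    · have h2 : (2 : K) * (α * χ (Pi.single 2 1) 2) = 0 := by
        linear_combination c3 - b3 - c1 + b1 + α * a3 - α * a7 + α * a5 - 2 * α * a1
      exact (mul_eq_zero.mp ((mul_eq_zero.mp h2).resolve_left two_ne_zero)).resolve_left hα
    · have h2 : (2 : K) * (β * χ (Pi.single 2 1) 2) = 0 := by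
        linear_combination c2 - b2 - c1 + b1 + β * a3 - β * a6 + β * a4 - 2 * β * a1
      exact (mul_eq_zero.mp ((mul_eq_zero.mp h2).resolve_left two_ne_zero)).resolve_left hβ
  have hX33 : χ (Pi.single 3 1) 3 = 0 := by linear_combination a3 - hX22 - a1 - a2
  have hX20 : χ (Pi.single 0 1) 2 = 0 := by linear_combination a6 - a2
  have hX21 : χ (Pi.single 1 1) 2 = 0 := by linear_combination a7 - a2
  have hX30 : χ (Pi.single 0 1) 3 = 0 := by linear_combination a4 - a1
  have hX31 : χ (Pi.single 1 1) 3 = 0 := by linear_combination a5 - a1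
  have C0 : β * χ (Pi.single 0 1) 0 + α * χ (Pi.single 0 1) 1 = 0 := by
    linear_combination c2 - c1 - β * hX22 - β * hX20
  have C1 : β * χ (Pi.single 1 1) 0 + α * χ (Pi.single 1 1) 1 = 0 := by
    linear_combination c3 - c1 - α * hX22 - α * hX21
  have C2 : β * χ (Pi.single 2 1) 0 + α * χ (Pi.single 2 1) 1 = 0 := by linear_combination c1
  have C3 : β * χ (Pi.single 3 1) 0 + α * χ (Pi.single 3 1) 1 = 0 := by linear_combination b1
  -- expand `u` in the basis
  have hχu : χ u = u 0 • χ (Pi.single 0 1) + u 1 • χ (Pi.single 1 1) + u 2 • χ (Pi.single 2 1) +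
      u 3 • χ (Pi.single 3 1) := by
    conv_lhs => rw [basis_expand u]
    simp only [map_add, map_smul]
  have L2 : χ u 2 = 0 := by
    rw [hχu]; simp only [Pi.add_apply, Pi.smul_apply, smul_eq_mul]
    linear_combination u 0 * hX20 + u 1 * hX21 + u 2 * hX22 + u 3 * a2
  have L3 : χ u 3 = 0 := by
    rw [hχu]; simp only [Pi.add_apply, Pi.smul_apply, smul_eq_mul]
    linear_combination u 0 * hX30 + u 1 * hX31 + u 2 * a1 + u 3 * hX33
  have L01 : β * χ u 0 + α * χ u 1 = 0 := by
    rw [hχu]; simp only [Pi.add_apply, Pi.smul_apply, smul_eq_mul]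
    linear_combination u 0 * C0 + u 1 * C1 + u 2 * C2 + u 3 * C3
  rcases hαβ with hα | hβ
  · refine ⟨χ u 0 / α, funext fun i => ?_⟩
    rcases fin4_cases i with rfl | rfl | rfl | rfl
    · simp [lvec]; field_simp
    · simp [lvec]; field_simp; linear_combination L01
    · simp [lvec, L2]
    · simp [lvec, L3]
  · refine ⟨-(χ u 1) / β, funext fun i => ?_⟩
    rcases fin4_cases i with rfl | rfl | rfl | rfl
    · simp [lvec]; field_simp; linear_combination L01
    · simp [lvec]; field_simp
    · simp [lvec, L2]
    · simp [lvec, L3]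

/-- **§3.5 / C12 PRODUCT ABSORPTION — PROVED** (rev 2.4; was `stub_productAbsorb`): transport to
`j = 0, c = 1` along `w ↦ w ∘ γ` (`T3_perm`), then `productAbsorb_01`. -/
theorem productAbsorb [CharZero K] : ProductAbsorb K := by
  intro j c α β χ hjc hαβ h u
  obtain ⟨γ, hγ0, hγ1⟩ := exists_perm_zero_one hjc
  let χ' : (Fin 4 → K) →ₗ[K] (Fin 4 → K) :=
    (compPermL (K := K) γ).comp (χ.comp (compPermL (K := K) γ.symm))
  have hχ' : ∀ u', χ' u' = (χ (u' ∘ γ.symm)) ∘ γ := fun _ => rfl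
  have h' : ∀ u' l, T3 u' (lvec 0 1 α β) (χ' u') l = 0 := by
    intro u' l
    have := h (u' ∘ γ.symm) (γ l)
    rw [← T3_perm γ, lvec_comp_perm hγ0 hγ1] at this
    have e1 : (u' ∘ γ.symm) ∘ γ = u' := by funext k; simp
    rwa [e1, ← hχ'] at this
  obtain ⟨μ, hμ⟩ := productAbsorb_01 α β χ' hαβ h' (u ∘ γ)
  have e2 : (u ∘ γ) ∘ γ.symm = u := by funext k; simp
  rw [hχ', e2, ← lvec_comp_perm hγ0 hγ1 α (-β)] at hμ
  refine ⟨μ, funext fun k => ?_⟩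
  have := congrFun hμ (γ.symm k)
  simpa using this

/-- **C13 GRAPH ABSORPTION — PROVED** (rev 2.4; was `stub_graphAbsorb`), from `ProductAbsorb` used
twice with `αβ = 0`: `v = e_j` shows that `ψ = χ + e φ` is absorbed by `e_j` (`ψ u ∈ K e_j`), `v = e_c`
that `ω = χ - e φ` is absorbed by `e_c`; then `2e φ_i = ψ_i - ω_i = 0` off `{j, c}` (char `0`) and
`χ = e σ φ` componentwise. -/
theorem graphAbsorb_of [CharZero K] (hPA : ProductAbsorb K) : GraphAbsorb K := by
  intro j c e φ χ hjc he h u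
  have hψ : ∀ u l, T3 u (lvec j c 1 0) ((χ + e • φ) u) l = 0 := by
    intro u l
    have hv : ∀ i, i ≠ j → i ≠ c → (Pi.single j 1 : Fin 4 → K) i = 0 := fun i hij _ => by
      simp [hij]
    have := h u (Pi.single j 1) hv l
    have hflip : flipAt c (Pi.single j 1 : Fin 4 → K) = Pi.single j 1 := by
      funext i
      by_cases hic : i = c
      · subst hic; simp [flipAt, hjc.symm]
      · simp [flipAt, hic]
    rw [hflip] at this
    have hl : (lvec j c 1 0 : Fin 4 → K) = Pi.single j 1 := by simp [lvec]
    rw [hl]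
    simp only [T3, LinearMap.add_apply, LinearMap.smul_apply, Pi.add_apply, Pi.smul_apply,
      smul_eq_mul] at this ⊢
    linear_combination this
  have hω : ∀ u l, T3 u (lvec j c 0 1) ((χ - e • φ) u) l = 0 := by
    intro u l
    have hv : ∀ i, i ≠ j → i ≠ c → (Pi.single c 1 : Fin 4 → K) i = 0 := fun i _ hic => by
      simp [hic]
    have := h u (Pi.single c 1) hv l
    have hflip : flipAt c (Pi.single c 1 : Fin 4 → K) = -Pi.single c 1 := by
      funext i
      by_cases hic : i = c
      · subst hic; simp [flipAt]
      · simp [flipAt, hic]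
    rw [hflip] at this
    have hl : (lvec j c 0 1 : Fin 4 → K) = Pi.single c 1 := by simp [lvec]
    rw [hl]
    simp only [T3, LinearMap.sub_apply, LinearMap.smul_apply, Pi.sub_apply,
      Pi.smul_apply, Pi.neg_apply, smul_eq_mul] at this ⊢
    linear_combination this
  obtain ⟨μ, hμ⟩ := hPA j c 1 0 (χ + e • φ) hjc (Or.inl one_ne_zero) hψ u
  obtain ⟨ν, hν⟩ := hPA j c 0 1 (χ - e • φ) hjc (Or.inr one_ne_zero) hω u
  have hψi : ∀ i, i ≠ j → χ u i + e * φ u i = 0 := by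
    intro i hij
    have := congrFun hμ i
    simp [lvec, hij] at this
    linear_combination this
  have hωi : ∀ i, i ≠ c → χ u i - e * φ u i = 0 := by
    intro i hic
    have := congrFun hν i
    simp [lvec, hic] at this
    linear_combination this
  refine ⟨fun i hij hic => ?_, funext fun i => ?_⟩
  · have h2 : (2 : K) * (e * φ u i) = 0 := by linear_combination hψi i hij - hωi i hic
    exact (mul_eq_zero.mp ((mul_eq_zero.mp h2).resolve_left two_ne_zero)).resolve_left he
  · by_cases hic : i = c
    · subst hic
      simp only [Pi.smul_apply, smul_eq_mul, flipAt, if_pos]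
      linear_combination hψi i (Ne.symm hjc)
    · simp only [Pi.smul_apply, smul_eq_mul, flipAt, if_neg hic]
      linear_combination hωi i hic

/-! #### Absorption: the master lemma (rev 2.4) -/

/-- The `4 × 4` permanent polarisation `⟨z, T3 (u, v, w)⟩` (fully symmetric). -/
def H4 (z u v w : Fin 4 → K) : K := ∑ l, z l * T3 u v w l

/-- Auxiliary: `H4_symm12` (val-idea-18, SING-SIX classification). [folklore] -/
theorem H4_symm12 (z u v w : Fin 4 → K) : H4 z u v w = H4 u z v w := by
  simp only [H4, Fin.sum_univ_four, T3, Fin.succAbove]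
  simp
  ring

/-- Auxiliary: `H4_single` (val-idea-18, SING-SIX classification). [folklore] -/
theorem H4_single (l : Fin 4) (u v w : Fin 4 → K) : H4 (Pi.single l 1) u v w = T3 u v w l := by
  fin_cases l <;> simp [H4, Fin.sum_univ_four]

/-- **ABSORPTION, MASTER LEMMA.**  If `T3 (u, b, χ u) = 0` for all `u` (a linear `χ`), then already
`T3 (u, b, χ u') = 0` for all `u, u'`: the trilinear scalar `H(z, u, u') = ⟨z, T3 (u, b, χ u')⟩` is
symmetric in `(z, u)` (symmetry of the polar matrix) and alternating in `(u, u')` (the hypothesis,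
polarised), and a tensor with these two symmetries vanishes in characteristic `≠ 2`. -/
theorem T3_absorb_all [CharZero K] (b : Fin 4 → K) (χ : (Fin 4 → K) →ₗ[K] (Fin 4 → K))
    (h : ∀ u l, T3 u b (χ u) l = 0) (u u' : Fin 4 → K) (l : Fin 4) : T3 u b (χ u') l = 0 := by
  have hpt : ∀ u u' l, T3 u b (χ u') l + T3 u' b (χ u) l = 0 := by
    intro u u' l
    have e1 := h (u + u') l
    rw [map_add, T3_add₁, T3_add₃, T3_add₃, h u l, h u' l] at e1
    linear_combination e1
  have hA : ∀ z u u', H4 z u b (χ u') = -H4 z u' b (χ u) := by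
    intro z u u'
    simp only [H4, ← Finset.sum_neg_distrib]
    refine Finset.sum_congr rfl fun l _ => ?_
    linear_combination z l * hpt u u' l
  have hH : ∀ z u u', H4 z u b (χ u') = 0 := by
    intro z u u'
    have c1 := H4_symm12 z u b (χ u')
    have c2 := hA u z u'
    have c3 := H4_symm12 u u' b (χ z)
    have c4 := hA u' u z
    have c5 := H4_symm12 u' z b (χ u)
    have c6 := hA z u' u
    have h2 : (2 : K) * H4 z u b (χ u') = 0 := by linear_combination c1 + c2 - c3 - c4 + c5 + c6
    exact (mul_eq_zero.mp h2).resolve_left two_ne_zero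
  have := hH (Pi.single l 1) u u'
  rwa [H4_single] at this

/-- Hence `b ⊥ χ u` for every `u`. -/
theorem permOrth_absorb [CharZero K] (b : Fin 4 → K) (χ : (Fin 4 → K) →ₗ[K] (Fin 4 → K))
    (h : ∀ u l, T3 u b (χ u) l = 0) (u : Fin 4 → K) : PermOrth b (χ u) :=
  permOrth_of_T3 fun u' l => T3_absorb_all b χ h u' u l

/-- **PURE-PLANE CORE — PROVED DIRECTLY** (rev 2.4; supersedes the route `SBShape → LemmaPhi →
PureCore` of `pureCore_of`, whose two stubs are thereby retired): by the master lemma every `b ∈ B`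
is perm-orthogonal to `w = φ u`; if `w_i ≠ 0` then `b ↦ b_i` is injective on `B`
(`b_q = -(w_q / w_i) b_i`), so `dim B ≤ 1` — contradiction. -/
theorem pureCore [CharZero K] : PureCore K := by
  intro φ B hB h
  refine LinearMap.ext fun u => funext fun i => ?_
  rw [LinearMap.zero_apply, Pi.zero_apply]
  by_contra hne
  have hperp : ∀ b ∈ B, PermOrth b (φ u) := fun b hb =>
    permOrth_absorb b φ (fun u' l => by rw [T3_swap₂₃]; exact h u' b hb l) u
  have hinj : ∀ b ∈ B, b i = 0 → b = 0 := by
    intro b hb hbi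
    funext q
    by_cases hq : q = i
    · rw [hq]; exact hbi
    · have := hperp b hb q i hq
      simp only [pairPerm] at this
      rw [hbi, zero_mul, add_zero] at this
      exact (mul_eq_zero.mp this).resolve_right hne
  have hle : finrank K B ≤ 1 := by
    let g : B →ₗ[K] K := (LinearMap.proj i).comp B.subtype
    have hg : Function.Injective g := by
      intro x y hxy
      apply Subtype.ext
      have h0 : ((x : Fin 4 → K) - (y : Fin 4 → K)) i = 0 := by
        rw [Pi.sub_apply]; exact sub_eq_zero.mpr hxy
      exact sub_eq_zero.mp (hinj _ (B.sub_mem x.2 y.2) h0)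
    have := LinearMap.finrank_le_finrank_of_injective hg
    simpa using this
  omega

/-! #### Perpendicular planes: covering by the pieces `E_{jc}` and the two rulings of `Q_jc` (rev 2.5) -/

/-- Arrays whose rows `s, t` are supported on the columns `{j, c}` (no condition on other rows). -/
def EJC (s t j c : Fin 4) : Submodule K (Fin 4 × Fin 4 → K) where
  carrier := {d | ∀ i, i ≠ j → i ≠ c → d (s, i) = 0 ∧ d (t, i) = 0}
  add_mem' := by
    intro a b ha hb i hij hic
    obtain ⟨h1, h2⟩ := ha i hij hic
    obtain ⟨h3, h4⟩ := hb i hij hic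
    simp [h1, h2, h3, h4]
  zero_mem' := by
    intro i _ _
    simp
  smul_mem' := by
    intro r a ha i hij hic
    obtain ⟨h1, h2⟩ := ha i hij hic
    simp [h1, h2]

/-- Auxiliary: `mem_EJC` (val-idea-18, SING-SIX classification). [folklore] -/
theorem mem_EJC {s t j c : Fin 4} {d : Fin 4 × Fin 4 → K} :
    d ∈ EJC (K := K) s t j c ↔ ∀ i, i ≠ j → i ≠ c → d (s, i) = 0 ∧ d (t, i) = 0 := Iff.rfl

/-- The pieces covering `D` pointwise, as submodules of `D`: `{row s = 0}`, `{row t = 0}` and the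
`E_{jc}` (all ordered pairs, the diagonal ones included for convenience). -/
def perpPiece (D : Submodule K (Fin 4 × Fin 4 → K)) (s t : Fin 4) :
    Option (Option (Fin 4 × Fin 4)) → Submodule K D
  | none => (LinearMap.ker (rowL (K := K) s)).comap D.subtype
  | some none => (LinearMap.ker (rowL (K := K) t)).comap D.subtype
  | some (some jc) => (EJC (K := K) s t jc.1 jc.2).comap D.subtype

/-- Auxiliary: `mem_perpPiece_none` (val-idea-18, SING-SIX classification). [folklore] -/
theorem mem_perpPiece_none {D : Submodule K (Fin 4 × Fin 4 → K)} {s t : Fin 4} {x : D} :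
    x ∈ perpPiece D s t none ↔ row (x : Fin 4 × Fin 4 → K) s = 0 := Iff.rfl

/-- Auxiliary: `mem_perpPiece_some_none` (val-idea-18, SING-SIX classification). [folklore] -/
theorem mem_perpPiece_some_none {D : Submodule K (Fin 4 × Fin 4 → K)} {s t : Fin 4} {x : D} :
    x ∈ perpPiece D s t (some none) ↔ row (x : Fin 4 × Fin 4 → K) t = 0 := Iff.rfl

/-- Auxiliary: `mem_perpPiece_some_some` (val-idea-18, SING-SIX classification). [folklore] -/
theorem mem_perpPiece_some_some {D : Submodule K (Fin 4 × Fin 4 → K)} {s t : Fin 4} {x : D}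
    {jc : Fin 4 × Fin 4} : x ∈ perpPiece D s t (some (some jc)) ↔
      ∀ i, i ≠ jc.1 → i ≠ jc.2 → (x : Fin 4 × Fin 4 → K) (s, i) = 0 ∧ (x : Fin 4 × Fin 4 → K) (t, i) = 0 :=
  Iff.rfl

/-- Parallel coordinate pairs: `(y₁, y₂) ≠ 0` and `x₁ y₂ = x₂ y₁` give `x = μ y`. -/
theorem exists_smul_of_par {x₁ x₂ y₁ y₂ : K} (hy : y₁ ≠ 0 ∨ y₂ ≠ 0) (h : x₁ * y₂ = x₂ * y₁) :
    ∃ μ : K, x₁ = μ * y₁ ∧ x₂ = μ * y₂ := by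
  rcases hy with hy | hy
  · refine ⟨x₁ / y₁, (div_mul_cancel₀ x₁ hy).symm, ?_⟩
    rw [div_mul_eq_mul_div, eq_div_iff hy]
    linear_combination (-1 : K) * h
  · refine ⟨x₂ / y₂, ?_, (div_mul_cancel₀ x₂ hy).symm⟩
    rw [div_mul_eq_mul_div, eq_div_iff hy]
    linear_combination h

/-- The product ruling plane's parametrisation
`(μ, ν) ↦ μ • (row s := ℓ(α, β)) + ν • (row t := ℓ(α, -β))`. -/
def prodGen (s t j c : Fin 4) (α β : K) : (K × K) →ₗ[K] (Fin 4 × Fin 4 → K) :=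
  (LinearMap.fst K K K).smulRight (rowAt s (lvec j c α β)) +
    (LinearMap.snd K K K).smulRight (rowAt t (lvec j c α (-β)))

/-- Auxiliary: `prodGen_apply` (val-idea-18, SING-SIX classification). [folklore] -/
theorem prodGen_apply (s t j c : Fin 4) (α β : K) (μν : K × K) :
    prodGen s t j c α β μν = μν.1 • rowAt s (lvec j c α β) + μν.2 • rowAt t (lvec j c α (-β)) :=
  rfl

end Summit.ValiantsHypothesis.ValiantsHypothesis.Theorems.SymPencilSingSixClassification

end
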